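import Literature.NumberTheory.EllipticCurves.HeegnerPointsKolyvaginPrimaryClassesProofs
import HarnessLib

/-!
# Naturality of Kolyvagin's classes under an equivariant endomorphism of `E(K̄)`

Gross 1991, proof of Prop. 5.4 (2): *"all the maps in the diagram (4.2) commute with the action
of `Gal(K/ℚ)`"*; McCallum 1991, §4 (6): the class `c(n)` is compatible with the maps of the
Kummer diagram. The tree proves this functoriality once and for all for McCallum's cocycle along
an arbitrary compatible pair (`KolyvaginCocycle.map_cls`,
`HeegnerPointsKolyvaginPrimaryClassesProofs`) and specialises it to complex conjugation
(`IsLiftOfAut.conjAct_kolyvaginClass`). This file records the other specialisation that the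
arithmetic of CM curves uses: the compatible pair `(id : Γ_K → Γ_K, φ : E(K̄) → E(K̄))` given by a
`Γ_K`-equivariant additive endomorphism `φ` of `E(K̄)` — printed: a `K`-rational endomorphism or
automorphism of `E` (for `j = 0`, the CM automorphism `[ω]`), acting on `H¹(K, E[n])` through its
restriction `fn = φ|E[n]`. For such `φ` preserving the admissible subgroup `A` (printed:
`A = E(K_n)`, preserved by any `K`-rational endomorphism),

  `H¹(fn) (c(P)) = c(φ P)`   in `H¹(K, E[n])`

for every `P ∈ A` with `(g - 1) P ∈ nA` for all `g` (`KolyvaginCocycle.invPoints`): the image of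
McCallum's cocycle `g ↦ gQ - Q - (g-1)P/n` under `fn` is `g ↦ g(φQ) - φQ - (g-1)(φP)/n` by the
uniqueness of `n`-th roots in `A`. This is the `kolyvaginClass`-level companion of the Kummer-class
statement `H¹(fn) ∘ δ = δ ∘ φ` (Serre, *Galois Cohomology*, I.§2.4), with the binder shapes
`φ / hφ / fn / hfn / hcoe` of that statement.

Theorem-only: no definition, named fact, instance or notation is introduced.

## Main statements

* `resH1Hom_id_kolyvaginClass` — `resH1Hom id fn (kolyvaginClass W n hdiv hA P hP) =
  kolyvaginClass W n hdiv hA (φ P) hP'`.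
* `map_mem_invPoints_of_equivariant` — `φ P ∈ invPoints` when `P ∈ invPoints` and `φ(A) ⊆ A`
  (the side condition `hP'`, supplied).
* `resH1Hom_id_kolyvaginClass'` — the same with `hP'` discharged internally.
* `kolyvaginClass_eq_smul_of_eq_smul_add_zsmul` — `c(P₂) = ε • c(P₁)` when `P₂ = ε • P₁ + n • B`,
  `B ∈ A` (the step from Gross's Prop. 5.4 (1) to Prop. 5.4 (2), congruence as input).
* `IsLiftOfAut.conjAct_kolyvaginClass_eq_smul_resH1Hom` — Prop. 5.4 (2) twisted by `φ`: from
  `τ P = ε • φ P + n • B` (the CM frame: the conjugate of a Kolyvagin point is congruent to a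
  CM-multiple), `σ_* c(P) = ε • H¹(fn) c(P)`; for `φ = id` this is the tree's
  `conjAct_kolyvaginClass_eq_smul`.

## References

* B. H. Gross, *Kolyvagin's work on modular elliptic curves*, in *`L`-functions and arithmetic
  (Durham, 1989)*, LMS Lecture Note Ser. 153, CUP (1991), 235–256: §4 (4.2), (4.4), (4.6) and the
  proof of Prop. 5.4 (2) (held `book:editornd-l-functions-arithmetic`, PDF pp. 218–222).
  [GrossLMS1991]
* W. G. McCallum, *Kolyvagin's work on Shafarevich–Tate groups*, same volume, 295–316: §4 (6),
  Lemma 4.1 (PDF pp. 281–283). [McCallumLMS1991]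
* J.-P. Serre, *Galois Cohomology* (1997), I.§2.4 (compatible pairs). [SerreGaloisCohomology1997]
-/

noncomputable section

open scoped Classical
open WeierstrassCurve
open Literature.NumberTheory.GaloisRepresentations

universe u v

namespace Literature.NumberTheory.EllipticCurves

open KolyvaginCocycle

variable {K : Type u} [Field K] {W : WeierstrassCurve K} {n : ℤ}
variable {hdiv : ∀ P : geomPoints W, ∃ Q : geomPoints W, n • Q = P}
variable {A : AddSubgroup (geomPoints W)}

/-- An additive `Γ_K`-equivariant `φ : E(K̄) → E(K̄)` with `φ(A) ⊆ A` maps `invPoints Γ_K A n` to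
itself: `(g-1)(φP) = φ((g-1)P) = n • φR`. The compatible pair is `(id, φ)`
(`KolyvaginCocycle.map_mem_invPoints`). [cite: McCallumLMS1991, §4 (4), (6)] -/
theorem map_mem_invPoints_of_equivariant (φ : geomPoints W →+ geomPoints W)
    (hφ : ∀ (g : Field.absoluteGaloisGroup K) (P : geomPoints W), φ (g • P) = g • φ P)
    (hφA : ∀ a ∈ A, φ a ∈ A) {P : geomPoints W}
    (hP : P ∈ invPoints (Field.absoluteGaloisGroup K) A n) :
    φ P ∈ invPoints (Field.absoluteGaloisGroup K) A n :=
  map_mem_invPoints (ContinuousMonoidHom.id _) φ (fun g m ↦ hφ g m) hφA hP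

/-- **Naturality of Kolyvagin's class under an equivariant endomorphism** (Gross 1991, proof of
Prop. 5.4 (2): *"all the maps in the diagram (4.2) commute"*; McCallum 1991, §4 (6)): for an
additive `Γ_K`-equivariant `φ` on `E(K̄)` preserving the admissible subgroup `A` and restricting
to `fn` on `E[n]` (`hcoe`), and `P ∈ A` with `(g-1)P ∈ nA` for all `g`,
`H¹(fn) (c(P)) = c(φ P)` in `H¹(K, E[n])` — McCallum's cocycle `g ↦ gQ - Q - (g-1)P/n` of `P`
(`nQ = P`) is carried by `fn` to the cocycle `g ↦ g(φQ) - φQ - (g-1)(φP)/n` of `φP`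
(`n(φQ) = φP`; the root `(g-1)P/n ∈ A` goes to the root `(g-1)(φP)/n ∈ A` by uniqueness,
`KolyvaginCocycle.map_cls` along the compatible pair `(id, φ)`), and Kolyvagin's class does not
depend on the chosen root (`kolyvaginClass_eq_cls`).
[cite: GrossLMS1991, Prop. 5.4 (2), §4 (4.2), (4.6)] [cite: McCallumLMS1991, §4 (6), Lemma 4.1] -/
theorem resH1Hom_id_kolyvaginClass (hA : IsAdmissible (Field.absoluteGaloisGroup K) A n)
    (φ : geomPoints W →+ geomPoints W)
    (hφ : ∀ (g : Field.absoluteGaloisGroup K) (P : geomPoints W), φ (g • P) = g • φ P)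
    (fn : geomTorsion W n →+ geomTorsion W n)
    (hfn : ∀ (g : Field.absoluteGaloisGroup K) (Q : geomTorsion W n),
      fn (ContinuousMonoidHom.id _ g • Q) = g • fn Q)
    (hcoe : ∀ Q : geomTorsion W n, ((fn Q : geomTorsion W n) : geomPoints W) = φ Q)
    (hφA : ∀ a ∈ A, φ a ∈ A)
    {P : geomPoints W} (hP : P ∈ invPoints (Field.absoluteGaloisGroup K) A n)
    (hP' : φ P ∈ invPoints (Field.absoluteGaloisGroup K) A n) :
    resH1Hom (ContinuousMonoidHom.id _) fn hfn (kolyvaginClass W n hdiv hA P hP) =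
      kolyvaginClass W n hdiv hA (φ P) hP' := by
  have hQ : n • Classical.choose (hdiv P) = P := Classical.choose_spec (hdiv P)
  have hQ' : n • φ (Classical.choose (hdiv P)) = φ P := by rw [← map_zsmul, hQ]
  rw [kolyvaginClass_eq_cls hA hP' hQ']
  unfold resH1Hom kolyvaginClass
  rw [LinearMap.toAddMonoidHom_coe, ContinuousLinearMap.coe_coe]
  exact map_cls (ContinuousMonoidHom.id _) φ (fun g m ↦ hφ g m) fn hcoe hfn hA hA hφA _ _ hP hQ
    hP' hQ'

/-- `resH1Hom_id_kolyvaginClass` with the side condition `φ P ∈ invPoints` discharged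
(`map_mem_invPoints_of_equivariant`). [cite: GrossLMS1991, Prop. 5.4 (2)]
[cite: McCallumLMS1991, §4 (6)] -/
theorem resH1Hom_id_kolyvaginClass' (hA : IsAdmissible (Field.absoluteGaloisGroup K) A n)
    (φ : geomPoints W →+ geomPoints W)
    (hφ : ∀ (g : Field.absoluteGaloisGroup K) (P : geomPoints W), φ (g • P) = g • φ P)
    (fn : geomTorsion W n →+ geomTorsion W n)
    (hfn : ∀ (g : Field.absoluteGaloisGroup K) (Q : geomTorsion W n),
      fn (ContinuousMonoidHom.id _ g • Q) = g • fn Q)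
    (hcoe : ∀ Q : geomTorsion W n, ((fn Q : geomTorsion W n) : geomPoints W) = φ Q)
    (hφA : ∀ a ∈ A, φ a ∈ A)
    {P : geomPoints W} (hP : P ∈ invPoints (Field.absoluteGaloisGroup K) A n) :
    resH1Hom (ContinuousMonoidHom.id _) fn hfn (kolyvaginClass W n hdiv hA P hP) =
      kolyvaginClass W n hdiv hA (φ P) (map_mem_invPoints_of_equivariant φ hφ hφA hP) :=
  resH1Hom_id_kolyvaginClass hA φ hφ fn hfn hcoe hφA hP _

/-! ## Congruent points, and Prop. 5.4 (2) twisted by an endomorphism -/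

/-- **Kolyvagin's class of a congruent point**: if `P₂ = ε • P₁ + n • B` with `B ∈ A` (both `P₁`,
`P₂` in `invPoints`), then `c(P₂) = ε • c(P₁)` in `H¹(K, E[n])` — McCallum's cocycle is additive
in `P` (`KolyvaginCocycle.cls_zsmul`) and kills `nA` (`KolyvaginCocycle.cls_add_zsmul`). This is
the step from Prop. 5.4 (1) to Prop. 5.4 (2) of Gross 1991 with the point congruence taken as
input (the tree's `conjAct_kolyvaginClass_eq_smul` is the case `P₂ = τ P₁`).
[cite: GrossLMS1991, Prop. 5.4] [cite: McCallumLMS1991, §4 (6), Lemma 4.1] -/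
theorem kolyvaginClass_eq_smul_of_eq_smul_add_zsmul
    (hA : IsAdmissible (Field.absoluteGaloisGroup K) A n) {P₁ P₂ : geomPoints W}
    (hP₁ : P₁ ∈ invPoints (Field.absoluteGaloisGroup K) A n)
    (hP₂ : P₂ ∈ invPoints (Field.absoluteGaloisGroup K) A n) (ε : ℤ) {B : geomPoints W}
    (hB : B ∈ A) (h : P₂ = ε • P₁ + n • B) :
    kolyvaginClass W n hdiv hA P₂ hP₂ = ε • kolyvaginClass W n hdiv hA P₁ hP₁ := by
  set Q := Classical.choose (hdiv P₁) with hQdef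
  have hQ : n • Q = P₁ := Classical.choose_spec (hdiv P₁)
  have hεP : ε • P₁ ∈ invPoints (Field.absoluteGaloisGroup K) A n :=
    (invPoints _ A n).zsmul_mem hP₁ ε
  have hεQ : n • (ε • Q) = ε • P₁ := by rw [smul_comm, hQ]
  have hP'' : ε • P₁ + n • B ∈ invPoints (Field.absoluteGaloisGroup K) A n := h ▸ hP₂
  have hQ'' : n • (ε • Q + B) = ε • P₁ + n • B := by rw [zsmul_add, hεQ]
  have h1 : kolyvaginClass W n hdiv hA P₂ hP₂ = cls hA (continuous_smul_geomPoints _) hP'' hQ'' := by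
    have hQ₂ : n • (ε • Q + B) = P₂ := by rw [hQ'', h]
    rw [kolyvaginClass_eq_cls hA hP₂ hQ₂]
    exact cls_congr hA _ h rfl
  rw [h1, cls_add_zsmul hA _ hεP hεQ hB hP'' hQ'', cls_zsmul hA _ hP₁ hQ ε hεP hεQ,
    kolyvaginClass_eq_cls hA hP₁ hQ]

/-- **Gross's Prop. 5.4 (2) twisted by an equivariant endomorphism** (the CM frame): for a lift
`τ` of `σ ∈ Aut(K/k)` to `K̄`, a `τ`-stable and `φ`-stable admissible `A`, `φ` a
`Γ_K`-equivariant additive endomorphism of `E(K̄)` restricting to `fn` on `E[n]`, and a point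
`P ∈ invPoints` whose conjugate is CONGRUENT TO A `φ`-MULTIPLE, `τ P = ε • φ P + n • B` with
`B ∈ A` (printed, `φ = id`: Prop. 5.4 (1) `τ P_n ≡ ε_n P_n (mod p E(K_n))`; on a CM curve the
congruence holds with `φ = [ζ]` a CM automorphism), the class satisfies
`σ_* c(P) = ε • H¹(fn) c(P)` in `H¹(K, E[n])` (printed: *"(2) The class `c(n)` lies in the
`ε_n`-eigenspace for `τ`"*) — by `IsLiftOfAut.conjAct_kolyvaginClass` (`σ_* c(P) = c(τP)`),
`kolyvaginClass_eq_smul_of_eq_smul_add_zsmul` and `resH1Hom_id_kolyvaginClass`.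
[cite: GrossLMS1991, Prop. 5.4 (2)] [cite: McCallumLMS1991, §4 (6)] -/
theorem IsLiftOfAut.conjAct_kolyvaginClass_eq_smul_resH1Hom {k : Type v} [Field k] [Algebra k K]
    (V : WeierstrassCurve k) {σ : K ≃ₐ[k] K} {τ : AlgebraicClosure K ≃+* AlgebraicClosure K}
    (hτ : IsLiftOfAut σ τ)
    {hdivV : ∀ P : geomPoints (V.baseChange K), ∃ Q : geomPoints (V.baseChange K), n • Q = P}
    {AV : AddSubgroup (geomPoints (V.baseChange K))}
    (hA : IsAdmissible (Field.absoluteGaloisGroup K) AV n) (hAτ : ∀ a ∈ AV, hτ.pointsMap V a ∈ AV)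
    (φ : geomPoints (V.baseChange K) →+ geomPoints (V.baseChange K))
    (hφ : ∀ (g : Field.absoluteGaloisGroup K) (P : geomPoints (V.baseChange K)), φ (g • P) = g • φ P)
    (fn : geomTorsion (V.baseChange K) n →+ geomTorsion (V.baseChange K) n)
    (hfn : ∀ (g : Field.absoluteGaloisGroup K) (Q : geomTorsion (V.baseChange K) n),
      fn (ContinuousMonoidHom.id _ g • Q) = g • fn Q)
    (hcoe : ∀ Q : geomTorsion (V.baseChange K) n,
      ((fn Q : geomTorsion (V.baseChange K) n) : geomPoints (V.baseChange K)) = φ Q)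
    (hφA : ∀ a ∈ AV, φ a ∈ AV)
    {P : geomPoints (V.baseChange K)} (hP : P ∈ invPoints (Field.absoluteGaloisGroup K) AV n)
    (ε : ℤ) (hcong : ∃ B ∈ AV, hτ.pointsMap V P = ε • φ P + n • B) :
    conjAct V σ n (kolyvaginClass (V.baseChange K) n hdivV hA P hP) =
      ε • resH1Hom (ContinuousMonoidHom.id _) fn hfn (kolyvaginClass (V.baseChange K) n hdivV hA P hP) := by
  obtain ⟨B, hB, hcong⟩ := hcong
  rw [hτ.conjAct_kolyvaginClass V hA hAτ hP (hτ.pointsMap_mem_invPoints V hAτ hP),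
    resH1Hom_id_kolyvaginClass hA φ hφ fn hfn hcoe hφA hP (map_mem_invPoints_of_equivariant φ hφ hφA hP)]
  exact kolyvaginClass_eq_smul_of_eq_smul_add_zsmul hA _ _ ε hB hcong

end Literature.NumberTheory.EllipticCurves
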